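import Literature.MathematicalPhysics.QuantumLattice.HubbardWindowCertificate
import Literature.MathematicalPhysics.QuantumLattice.DWaveSource
import Literature.MathematicalPhysics.QuantumLattice.PairFieldMomentum
import Literature.MathematicalPhysics.QuantumLattice.HubbardModelGrandCanonicalProofs
import HarnessLib

/-!
# The window Hamiltonian of the `d`-wave pair-sourced Hubbard model and its torus pull-back

Topic `MathematicalPhysics/QuantumLattice` (sequel of `HubbardWindowCertificate.lean` and
`HubbardTorusLocalHamiltonianDecomposition.lean`; continued in `DWaveSourceWindowCertificate.lean`).

The pair-sourced grand-canonical Hubbard Hamiltonian on the `L × L` torus is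
`A_L = H_L(1,U) − μ N_L − h (Δ_L + Δ_Lᴴ)` (`dWaveSourceTorus L U μ h` of `DWaveSource.lean`), with
`Δ_L = Σ_x Δ_x`, `Δ_x = Σ_{e ∈ {0, ±e₁, ±e₂}} (g(e)/√2)(c_{x↑}c_{x+e,↓} − c_{x↓}c_{x+e,↑})`,
`g = dWaveFormFactor` (Koma–Tasaki 1994 §1, the symmetry-breaking pair field). It conserves fermion
parity and `S^z` but NOT the particle number. This file supplies the window-side operator algebra
behind the finite-volume soundness of a translation-invariant bootstrap certificate (Han 2020 §3:
positivity / stationarity `⟨[H,O]⟩ = 0` / symmetry / conserved-charge constraints; Bratteli–Robinson II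
§6.2.4, periodic boxes) for the energy per site of `A_L` (`DWaveSourceWindowCertificate.lean`):

* `pairSourceWindow g Λ'` — the pair source of a finite window `Λ' ⊆ ℤ²` (all bonds `(x, x+e)`,
  `e ∈ {0, ±e₁, ±e₂}`, with both ends in `Λ'`), and the free-boundary sourced window Hamiltonian
  `pairSourceWindowHamiltonian g Λ' U μ h = H_{Λ'}(1,U) − μ N_{Λ'} − h (S_{Λ'} + S_{Λ'}ᴴ)`;
* PULL-BACKS along `x ↦ x mod L` (`fermionEmbed_toTorusEmb_pairSourceWindow`,
  `fermionEmbed_toTorusEmb_totalNumber`) and the FAR PARTS `Δ_L − Γ(S_{Λ'})`, `N_L − Γ(N_{Λ'})`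
  (`pairField_sub_fermionEmbed_pairSourceWindow`, `totalNumber_sub_fermionEmbed_totalNumber`);
* EVENNESS AND SUPPORT: for an inner region `Λ` all of whose lattice neighbours lie in `Λ'` and
  `x ↦ x mod L` injective on `thicken Λ' 1`, both far parts (and the adjoint of the first) lie in the
  even CAR subalgebra of the orbitals OFF the image of `Λ`
  (`pairField_sub_fermionEmbed_pairSourceWindow_mem`, `…_conjTranspose_mem`,
  `totalNumber_sub_fermionEmbed_totalNumber_mem`) — the input of graded locality
  (Bratteli–Robinson II §5.2.2) used in the sequel to make Han's window stationarity constraints exact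
  on every torus.

Implementation note: on the concrete torus type only the additive and scalar structure of the CAR
subalgebras is invoked (`add_mem`, `sum_mem`, `SMulMemClass.smul_mem`), never `sub_mem`, whose `Ring`
synthesis picks a decidability instance different from the one inside `carEvenSubalgebra`.
-/

noncomputable section

namespace Literature.MathematicalPhysics.QuantumLattice

open Matrix Finset HubbardWave0 Literature.Probability.LatticeModels
open scoped ComplexOrder BigOperators

/-! ### The step set `{0, ±e₁, ±e₂}` -/

section Steps

/-- Case analysis of `e ∈ {0} ∪ unitSteps`. [folklore] -/
private theorem eq_or_of_mem_insert_zero_unitSteps {e : Site 2} (he : e ∈ insert (0 : Site 2) unitSteps) :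
    e = 0 ∨ ∃ i : Fin 2, e = unitVec i ∨ e = -unitVec i := by
  simp only [unitSteps, Finset.mem_insert, Finset.mem_singleton] at he
  rcases he with h | h | h | h | h
  · exact Or.inl h
  · exact Or.inr ⟨0, Or.inl h⟩
  · exact Or.inr ⟨0, Or.inr h⟩
  · exact Or.inr ⟨1, Or.inl h⟩
  · exact Or.inr ⟨1, Or.inr h⟩

/-- `{0} ∪ unitSteps` is symmetric under `e ↦ −e`. [folklore] -/
private theorem neg_mem_insert_zero_unitSteps {e : Site 2} (he : e ∈ insert (0 : Site 2) unitSteps) :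
    -e ∈ insert (0 : Site 2) unitSteps := by
  rcases eq_or_of_mem_insert_zero_unitSteps he with rfl | ⟨i, rfl | rfl⟩
  · rw [neg_zero]; exact Finset.mem_insert_self _ _
  · refine Finset.mem_insert_of_mem ?_
    fin_cases i <;> simp [unitSteps, unitVec]
  · rw [neg_neg]
    refine Finset.mem_insert_of_mem ?_
    fin_cases i <;> simp [unitSteps, unitVec]

/-- `{0, ±e₁, ±e₂} ⊆ thicken {0} 1` (the unit cube around the origin). [folklore] -/
private theorem insert_zero_unitSteps_subset_thicken :
    insert (0 : Site 2) unitSteps ⊆ thicken ({0} : Finset (Site 2)) 1 := by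
  intro e he
  rcases eq_or_of_mem_insert_zero_unitSteps he with rfl | ⟨i, rfl | rfl⟩
  · exact subset_thicken _ _ (Finset.mem_singleton_self _)
  · exact unitVec_mem_thicken_one i
  · exact neg_unitVec_mem_thicken_one i

variable {Λ Λ' : Finset (Site 2)}

/-- If all lattice neighbours of `Λ` lie in `Λ'`, then `x + e ∈ Λ'` for `x ∈ Λ`, `e ∈ {0, ±e₁, ±e₂}`.
[folklore] -/
private theorem add_mem_of_neighbours_mem (hΛ : Λ ⊆ Λ')
    (hclosed : ∀ x ∈ Λ, ∀ i : Fin 2, x + unitVec i ∈ Λ' ∧ x - unitVec i ∈ Λ') {x : Site 2} (hx : x ∈ Λ)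
    {e : Site 2} (he : e ∈ insert (0 : Site 2) unitSteps) : x + e ∈ Λ' := by
  rcases eq_or_of_mem_insert_zero_unitSteps he with rfl | ⟨i, rfl | rfl⟩
  · rw [add_zero]; exact hΛ hx
  · exact (hclosed x hx i).1
  · rw [← sub_eq_add_neg]; exact (hclosed x hx i).2

/-- If all lattice neighbours of `Λ` lie in `Λ'`, then `x − e ∈ Λ'` for `x ∈ Λ`, `e ∈ {0, ±e₁, ±e₂}`.
[folklore] -/
private theorem sub_mem_of_neighbours_mem (hΛ : Λ ⊆ Λ')
    (hclosed : ∀ x ∈ Λ, ∀ i : Fin 2, x + unitVec i ∈ Λ' ∧ x - unitVec i ∈ Λ') {x : Site 2} (hx : x ∈ Λ)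
    {e : Site 2} (he : e ∈ insert (0 : Site 2) unitSteps) : x - e ∈ Λ' := by
  rw [sub_eq_add_neg]
  exact add_mem_of_neighbours_mem hΛ hclosed hx (neg_mem_insert_zero_unitSteps he)

end Steps

/-! ### The pair source of a window and the sourced window Hamiltonian -/

section Window

variable (g : Site 2 → ℝ)

/-- **The pair source of a finite window** `Λ' ⊆ ℤ²`:
`S_{Λ'} = Σ_{x ∈ Λ'} Σ_{e ∈ {0,±e₁,±e₂}, x+e ∈ Λ'} (g(e)/√2)(c_{x↑} c_{x+e,↓} − c_{x↓} c_{x+e,↑}) ∈ 𝔄_{Λ'}`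
(every bond of the extended-`s`/`d`-wave pair field with both ends in the window). Koma–Tasaki (1994)
§1 (the local pair-field order parameter); Scalapino, Phys. Rep. 250 (1995) §2 eq. (2.2).
[cite: KomaTasaki1994, §1] -/
def pairSourceWindow (Λ' : Finset (Site 2)) : FermionOp Λ' :=
  ∑ x ∈ Λ'.attach, ∑ e ∈ insert (0 : Site 2) unitSteps,
    if h : x.1 + e ∈ Λ' then ((g e / Real.sqrt 2 : ℝ) : ℂ) •
      (cAt x.1 x.2 0 * cAt (x.1 + e) h 1 - cAt x.1 x.2 1 * cAt (x.1 + e) h 0) else 0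

/-- **The pair-sourced free-boundary window Hamiltonian**
`H^src_{Λ'} = H_{Λ'}(1, U) − μ N_{Λ'} − h (S_{Λ'} + S_{Λ'}ᴴ) ∈ 𝔄_{Λ'}` (`H_{Λ'}` the free-boundary Hubbard
Hamiltonian `(hubbardFermionInteraction 2 1 U).localHamiltonian Λ'`, `N_{Λ'}` the window particle
number). Koma–Tasaki (1994) §1 (Hubbard Hamiltonian plus symmetry-breaking pair source).
[cite: KomaTasaki1994, §1] -/
def pairSourceWindowHamiltonian (Λ' : Finset (Site 2)) (U μ h : ℝ) : FermionOp Λ' :=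
  (hubbardFermionInteraction 2 1 U).localHamiltonian Λ' - (μ : ℂ) • (totalNumber : FermionOp Λ') -
    (h : ℂ) • (pairSourceWindow g Λ' + (pairSourceWindow g Λ')ᴴ)

variable (L : ℕ) [NeZero L]

omit [NeZero L] in
/-- `x ↦ x mod L` is additive. [folklore] -/
private theorem proj_add (x y : Site 2) : Torus.proj L (x + y) = Torus.proj L x + Torus.proj L y := by
  funext i
  simp [Torus.proj]

omit [NeZero L] in
/-- `x ↦ x mod L` respects subtraction. [folklore] -/
private theorem proj_sub (x y : Site 2) : Torus.proj L (x - y) = Torus.proj L x - Torus.proj L y := by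
  funext i
  simp [Torus.proj]

/-- **Pull-back of the window pair source**: `Γ(S_{Λ'}) = Σ_{x ∈ Λ', e, x+e ∈ Λ'} (g(e)/√2) b_{x̄, e}`
with `b_{a,e}` the torus singlet bond `singletBond L a e`. [cite: BratteliRobinsonII1997, §6.2.1] -/
theorem fermionEmbed_toTorusEmb_pairSourceWindow {Λ' : Finset (Site 2)}
    (hInj' : Set.InjOn (Torus.proj (d := 2) L) ↑Λ') :
    fermionEmbed (PolySite.toTorusEmb L hInj') (pairSourceWindow g Λ') =
      ∑ x ∈ Λ', ∑ e ∈ insert (0 : Site 2) unitSteps,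
        if x + e ∈ Λ' then ((g e / Real.sqrt 2 : ℝ) : ℂ) • singletBond L (Torus.proj L x) e else 0 := by
  unfold pairSourceWindow
  rw [fermionEmbed_sum, ← Finset.sum_attach Λ' (fun x => ∑ e ∈ insert (0 : Site 2) unitSteps,
    if x + e ∈ Λ' then ((g e / Real.sqrt 2 : ℝ) : ℂ) • singletBond L (Torus.proj L x) e else 0)]
  refine Finset.sum_congr rfl fun x _ => ?_
  rw [fermionEmbed_sum]
  refine Finset.sum_congr rfl fun e _ => ?_
  by_cases hxe : x.1 + e ∈ Λ'
  · rw [dif_pos hxe, if_pos hxe, fermionEmbed_smul, fermionEmbed_sub, fermionEmbed_mul, fermionEmbed_mul]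
    simp only [cAt, fermionEmbed_annihilation, PolySite.toTorusEmb_apply, PolySite.ofLex_coe_pt, proj_add,
      singletBond]
  · rw [dif_neg hxe, if_neg hxe, fermionEmbed_zero]

/-- `Δ_g(L)` as the explicit double sum of singlet bonds (definitional). [cite: KomaTasaki1994, §1] -/
theorem pairField_eq_sum_sum_singletBond :
    pairField g L = ∑ a : TorusSite 2 L, ∑ e ∈ insert (0 : Site 2) unitSteps,
      ((g e / Real.sqrt 2 : ℝ) : ℂ) • singletBond L a e := rfl

/-- **Far decomposition of the torus pair field**: with `x ↦ x mod L` injective on `Λ'`,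
`Δ_L − Γ(S_{Λ'}) = Σ_{x ∈ Λ', e, x+e ∉ Λ'} (g(e)/√2) b_{x̄,e} + Σ_{a ∉ Λ̄', e} (g(e)/√2) b_{a,e}`
(the bonds of the torus not entirely inside the image of the window).
[cite: BratteliRobinsonII1997, §6.2.1 (H_Λ' = H_Λ + W)] -/
theorem pairField_sub_fermionEmbed_pairSourceWindow {Λ' : Finset (Site 2)}
    (hInj' : Set.InjOn (Torus.proj (d := 2) L) ↑Λ') :
    pairField g L - fermionEmbed (PolySite.toTorusEmb L hInj') (pairSourceWindow g Λ') =
      ∑ x ∈ Λ', ∑ e ∈ insert (0 : Site 2) unitSteps,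
          (if x + e ∉ Λ' then ((g e / Real.sqrt 2 : ℝ) : ℂ) • singletBond L (Torus.proj L x) e else 0) +
        ∑ a ∈ (Λ'.image (Torus.proj L))ᶜ, ∑ e ∈ insert (0 : Site 2) unitSteps,
          ((g e / Real.sqrt 2 : ℝ) : ℂ) • singletBond L a e := by
  rw [fermionEmbed_toTorusEmb_pairSourceWindow, pairField_eq_sum_sum_singletBond,
    ← Finset.sum_add_sum_compl (Λ'.image (Torus.proj L)), Finset.sum_image hInj']
  have hsplit : ∀ x ∈ Λ', ∑ e ∈ insert (0 : Site 2) unitSteps,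
      ((g e / Real.sqrt 2 : ℝ) : ℂ) • singletBond L (Torus.proj L x) e =
      (∑ e ∈ insert (0 : Site 2) unitSteps,
        if x + e ∈ Λ' then ((g e / Real.sqrt 2 : ℝ) : ℂ) • singletBond L (Torus.proj L x) e else 0) +
      ∑ e ∈ insert (0 : Site 2) unitSteps,
        (if x + e ∉ Λ' then ((g e / Real.sqrt 2 : ℝ) : ℂ) • singletBond L (Torus.proj L x) e else 0) := by
    intro x _
    rw [← Finset.sum_add_distrib]
    refine Finset.sum_congr rfl fun e _ => ?_
    by_cases hxe : x + e ∈ Λ'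
    · rw [if_pos hxe, if_neg (not_not.2 hxe), add_zero]
    · rw [if_neg hxe, if_pos hxe, zero_add]
  rw [Finset.sum_congr rfl hsplit, Finset.sum_add_distrib]
  abel

section Even

variable {ι : Type*} [LinearOrder ι] [Fintype ι] {S : Finset ι}

/-- `c_i c_j` is even for `i, j ∈ S`. [folklore] -/
private theorem annihilation_mul_annihilation_mem_carEvenSubalgebra {i j : ι} (hi : i ∈ S) (hj : j ∈ S) :
    annihilation i * annihilation j ∈ carEvenSubalgebra S :=
  Algebra.subset_adjoin ⟨(i, false), (j, false), hi, hj, rfl⟩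

/-- `c†_i c†_j` is even for `i, j ∈ S`. [folklore] -/
private theorem creation_mul_creation_mem_carEvenSubalgebra {i j : ι} (hi : i ∈ S) (hj : j ∈ S) :
    creation i * creation j ∈ carEvenSubalgebra S :=
  Algebra.subset_adjoin ⟨(i, true), (j, true), hi, hj, rfl⟩

/-- `S^z` commutes with `N` (both are diagonal in the occupation basis). [cite: Tasaki2020, §9.3.1] -/
theorem spinZ_commute_totalNumber {Λ : Type*} [LinearOrder Λ] [Fintype Λ] :
    Commute (HubbardWave0.spinZ : Matrix (Finset (Orb Λ)) (Finset (Orb Λ)) ℂ) totalNumber := by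
  rw [Commute, SemiconjBy, LiebThm1.totalNumber_eq_diagonal, LiebThm1.spinZ_eq_diagonal, diagonal_mul_diagonal,
    diagonal_mul_diagonal]
  congr 1
  funext s
  ring

end Even

variable {L}

/-- A torus singlet bond `b_{a,e}` both of whose sites avoid `I` is an even element supported off the
orbitals over `I`. [folklore] -/
private theorem singletBond_mem_carEvenSubalgebra_compl {I : Finset (FermionTorus 2 L)} {a : TorusSite 2 L}
    {e : Site 2} (ha : FermionTorus.ofTorusSite a ∉ I)
    (hb : FermionTorus.ofTorusSite (a + Torus.proj L e) ∉ I) :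
    singletBond L a e ∈ carEvenSubalgebra (orbs I)ᶜ := by
  have ha' : ∀ σ : Fin 2, orb (FermionTorus.ofTorusSite a) σ ∈ (orbs I)ᶜ := fun σ =>
    Finset.mem_compl.2 fun h => ha (orb_mem_orbs.1 h)
  have hb' : ∀ σ : Fin 2, orb (FermionTorus.ofTorusSite (a + Torus.proj L e)) σ ∈ (orbs I)ᶜ := fun σ =>
    Finset.mem_compl.2 fun h => hb (orb_mem_orbs.1 h)
  -- `x - y = x + (-1) • y`: only the additive and scalar structure is used (no `Ring` synthesis)
  rw [singletBond, sub_eq_add_neg, ← neg_one_smul ℂ (annihilation (orb (FermionTorus.ofTorusSite a) 1) * _)]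
  exact add_mem (annihilation_mul_annihilation_mem_carEvenSubalgebra (ha' 0) (hb' 1))
    (SMulMemClass.smul_mem _ (annihilation_mul_annihilation_mem_carEvenSubalgebra (ha' 1) (hb' 0)))

/-- The adjoint of a torus singlet bond both of whose sites avoid `I` is an even element supported off
the orbitals over `I`. [folklore] -/
private theorem singletBond_conjTranspose_mem_carEvenSubalgebra_compl {I : Finset (FermionTorus 2 L)}
    {a : TorusSite 2 L} {e : Site 2} (ha : FermionTorus.ofTorusSite a ∉ I)
    (hb : FermionTorus.ofTorusSite (a + Torus.proj L e) ∉ I) :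
    (singletBond L a e)ᴴ ∈ carEvenSubalgebra (orbs I)ᶜ := by
  have ha' : ∀ σ : Fin 2, orb (FermionTorus.ofTorusSite a) σ ∈ (orbs I)ᶜ := fun σ =>
    Finset.mem_compl.2 fun h => ha (orb_mem_orbs.1 h)
  have hb' : ∀ σ : Fin 2, orb (FermionTorus.ofTorusSite (a + Torus.proj L e)) σ ∈ (orbs I)ᶜ := fun σ =>
    Finset.mem_compl.2 fun h => hb (orb_mem_orbs.1 h)
  rw [singletBond_conjTranspose, sub_eq_add_neg,
    ← neg_one_smul ℂ (creation (orb (FermionTorus.ofTorusSite (a + Torus.proj L e)) 0) * _)]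
  exact add_mem (creation_mul_creation_mem_carEvenSubalgebra (hb' 1) (ha' 0))
    (SMulMemClass.smul_mem _ (creation_mul_creation_mem_carEvenSubalgebra (hb' 0) (ha' 1)))

variable (L)

/-- For `Λ ⊆ Λ'` with all lattice neighbours of `Λ` in `Λ'` and `x ↦ x mod L` injective on
`thicken Λ' 1`: (1) a bond `(x̄, x̄ + ē)` with `x ∈ Λ'`, `x + e ∉ Λ'` avoids the image of `Λ`;
(2) a bond starting outside the image of `Λ'` avoids the image of `Λ`. [folklore] -/
private theorem far_pairBonds_not_mem_image {Λ Λ' : Finset (Site 2)} (hΛ : Λ ⊆ Λ')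
    (hclosed : ∀ x ∈ Λ, ∀ i : Fin 2, x + unitVec i ∈ Λ' ∧ x - unitVec i ∈ Λ')
    (hInj : Set.InjOn (Torus.proj (d := 2) L) ↑(thicken Λ' 1)) :
    (∀ x ∈ Λ', ∀ e ∈ insert (0 : Site 2) unitSteps, x + e ∉ Λ' →
      FermionTorus.ofTorusSite (Torus.proj L x) ∉ Λ.image (fun x => FermionTorus.ofTorusSite (Torus.proj L x)) ∧
        FermionTorus.ofTorusSite (Torus.proj L x + Torus.proj L e) ∉
          Λ.image (fun x => FermionTorus.ofTorusSite (Torus.proj L x))) ∧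
    (∀ a ∈ (Λ'.image (Torus.proj L))ᶜ, ∀ e ∈ insert (0 : Site 2) unitSteps,
      FermionTorus.ofTorusSite a ∉ Λ.image (fun x => FermionTorus.ofTorusSite (Torus.proj L x)) ∧
        FermionTorus.ofTorusSite (a + Torus.proj L e) ∉
          Λ.image (fun x => FermionTorus.ofTorusSite (Torus.proj L x))) := by
  have hInj' : Set.InjOn (Torus.proj (d := 2) L) ↑Λ' := hInj.mono (by exact_mod_cast subset_thicken Λ' 1)
  -- membership in the image of `Λ` forces a preimage in `Λ`
  have hpre : ∀ a : TorusSite 2 L, FermionTorus.ofTorusSite a ∈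
      Λ.image (fun x => FermionTorus.ofTorusSite (Torus.proj L x)) → ∃ y ∈ Λ, Torus.proj L y = a := by
    intro a ha
    obtain ⟨y, hy, hya⟩ := Finset.mem_image.1 ha
    exact ⟨y, hy, by simpa using congrArg FermionTorus.toTorusSite hya⟩
  constructor
  · intro x hx e he hxe
    constructor
    · intro h
      obtain ⟨y, hy, hyx⟩ := hpre _ h
      have : y = x := hInj' (hΛ hy) hx hyx
      subst this
      exact hxe (add_mem_of_neighbours_mem hΛ hclosed hy he)
    · intro h
      obtain ⟨y, hy, hyx⟩ := hpre _ h
      rw [← proj_add] at hyx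
      have : y = x + e := hInj (subset_thicken Λ' 1 (hΛ hy))
        (add_mem_thicken_one hx (insert_zero_unitSteps_subset_thicken he)) hyx
      subst this
      exact hxe (hΛ hy)
  · intro a ha e he
    rw [Finset.mem_compl, Finset.mem_image] at ha
    constructor
    · intro h
      obtain ⟨y, hy, hya⟩ := hpre _ h
      exact ha ⟨y, hΛ hy, hya⟩
    · intro h
      obtain ⟨y, hy, hya⟩ := hpre _ h
      refine ha ⟨y - e, sub_mem_of_neighbours_mem hΛ hclosed hy he, ?_⟩
      rw [proj_sub, hya, add_sub_cancel_right]

/-- **The far part of the pair field is even and supported off `Γ(𝔄_Λ)`**: for `Λ ⊆ Λ'` with all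
lattice neighbours of `Λ` in `Λ'` and `x ↦ x mod L` injective on `thicken Λ' 1`, `Δ_L − Γ(S_{Λ'})`
lies in the even CAR subalgebra of the orbitals OFF the image of `Λ`.
[cite: BratteliRobinsonII1997, §6.2.1 and §5.2.2] -/
theorem pairField_sub_fermionEmbed_pairSourceWindow_mem {Λ Λ' : Finset (Site 2)} (hΛ : Λ ⊆ Λ')
    (hclosed : ∀ x ∈ Λ, ∀ i : Fin 2, x + unitVec i ∈ Λ' ∧ x - unitVec i ∈ Λ')
    (hInj : Set.InjOn (Torus.proj (d := 2) L) ↑(thicken Λ' 1)) :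
    pairField g L - fermionEmbed (PolySite.toTorusEmb L (hInj.mono (by exact_mod_cast subset_thicken Λ' 1)))
        (pairSourceWindow g Λ') ∈
      carEvenSubalgebra (orbs (Λ.image fun x => FermionTorus.ofTorusSite (Torus.proj L x)))ᶜ := by
  obtain ⟨key1, key2⟩ := far_pairBonds_not_mem_image L hΛ hclosed hInj
  rw [pairField_sub_fermionEmbed_pairSourceWindow]
  refine add_mem (sum_mem fun x hx => sum_mem fun e he => ?_) (sum_mem fun a ha => sum_mem fun e he => ?_)
  · by_cases hxe : x + e ∉ Λ'
    · rw [if_pos hxe]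
      exact SMulMemClass.smul_mem _
        (singletBond_mem_carEvenSubalgebra_compl (key1 x hx e he hxe).1 (key1 x hx e he hxe).2)
    · rw [if_neg hxe]; exact zero_mem _
  · exact SMulMemClass.smul_mem _ (singletBond_mem_carEvenSubalgebra_compl (key2 a ha e he).1 (key2 a ha e he).2)

/-- The adjoint of the far part of the pair field is even and supported off `Γ(𝔄_Λ)`.
[cite: BratteliRobinsonII1997, §6.2.1 and §5.2.2] -/
theorem pairField_sub_fermionEmbed_pairSourceWindow_conjTranspose_mem {Λ Λ' : Finset (Site 2)} (hΛ : Λ ⊆ Λ')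
    (hclosed : ∀ x ∈ Λ, ∀ i : Fin 2, x + unitVec i ∈ Λ' ∧ x - unitVec i ∈ Λ')
    (hInj : Set.InjOn (Torus.proj (d := 2) L) ↑(thicken Λ' 1)) :
    (pairField g L - fermionEmbed (PolySite.toTorusEmb L (hInj.mono (by exact_mod_cast subset_thicken Λ' 1)))
        (pairSourceWindow g Λ'))ᴴ ∈
      carEvenSubalgebra (orbs (Λ.image fun x => FermionTorus.ofTorusSite (Torus.proj L x)))ᶜ := by
  obtain ⟨key1, key2⟩ := far_pairBonds_not_mem_image L hΛ hclosed hInj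
  rw [pairField_sub_fermionEmbed_pairSourceWindow, conjTranspose_add, conjTranspose_sum, conjTranspose_sum]
  refine add_mem (sum_mem fun x hx => ?_) (sum_mem fun a ha => ?_)
  · rw [conjTranspose_sum]
    refine sum_mem fun e he => ?_
    by_cases hxe : x + e ∉ Λ'
    · rw [if_pos hxe, conjTranspose_smul]
      exact SMulMemClass.smul_mem _
        (singletBond_conjTranspose_mem_carEvenSubalgebra_compl (key1 x hx e he hxe).1 (key1 x hx e he hxe).2)
    · rw [if_neg hxe, conjTranspose_zero]; exact zero_mem _
  · rw [conjTranspose_sum]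
    refine sum_mem fun e he => ?_
    rw [conjTranspose_smul]
    exact SMulMemClass.smul_mem _
      (singletBond_conjTranspose_mem_carEvenSubalgebra_compl (key2 a ha e he).1 (key2 a ha e he).2)

/-- **Pull-back of the window particle number**: `Γ(N_{Λ'}) = Σ_{x ∈ Λ'} Σ_σ n_{x̄ σ}`.
[cite: BratteliRobinsonII1997, §6.2.1] -/
theorem fermionEmbed_toTorusEmb_totalNumber {Λ' : Finset (Site 2)}
    (hInj' : Set.InjOn (Torus.proj (d := 2) L) ↑Λ') :
    fermionEmbed (PolySite.toTorusEmb L hInj') (totalNumber : FermionOp Λ') =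
      ∑ x ∈ Λ', ∑ σ : Fin 2, numberOp (FermionTorus.ofTorusSite (Torus.proj L x)) σ := by
  rw [totalNumber, fermionEmbed_sum]
  -- reindex `PolySite Λ' ≃ Λ'`
  let ε : PolySite Λ' ≃ {x // x ∈ Λ'} :=
    ⟨fun a => ⟨ofLex a.1, PolySite.ofLex_mem a⟩, fun x => PolySite.pt x.1 x.2, fun a => PolySite.pt_ofLex a,
      fun x => Subtype.ext rfl⟩
  rw [← Finset.sum_attach Λ', ← Finset.univ_eq_attach]
  refine Fintype.sum_equiv ε _ _ fun a => ?_
  rw [fermionEmbed_sum]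
  refine Finset.sum_congr rfl fun σ _ => ?_
  rw [fermionEmbed_numberOp, PolySite.toTorusEmb_apply]
  rfl

/-- **Far decomposition of the torus particle number**: `N_L − Γ(N_{Λ'}) = Σ_{a ∉ Λ̄'} Σ_σ n_{aσ}`.
[cite: BratteliRobinsonII1997, §6.2.1 (H_Λ' = H_Λ + W)] -/
theorem totalNumber_sub_fermionEmbed_totalNumber {Λ' : Finset (Site 2)}
    (hInj' : Set.InjOn (Torus.proj (d := 2) L) ↑Λ') :
    (totalNumber : Matrix (Finset (Orb (FermionTorus 2 L))) (Finset (Orb (FermionTorus 2 L))) ℂ) -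
        fermionEmbed (PolySite.toTorusEmb L hInj') (totalNumber : FermionOp Λ') =
      ∑ a ∈ (Λ'.image fun x => FermionTorus.ofTorusSite (Torus.proj L x))ᶜ, ∑ σ : Fin 2, numberOp a σ := by
  have hι := injOn_ofTorusSite_proj L hInj'
  rw [fermionEmbed_toTorusEmb_totalNumber, totalNumber,
    ← Finset.sum_add_sum_compl (Λ'.image fun x => FermionTorus.ofTorusSite (Torus.proj L x)),
    Finset.sum_image hι, add_sub_cancel_left]

/-- The far part of the particle number is even and supported off `Γ(𝔄_Λ)` (`Λ ⊆ Λ'`).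
[cite: BratteliRobinsonII1997, §6.2.1 and §5.2.2] -/
theorem totalNumber_sub_fermionEmbed_totalNumber_mem {Λ Λ' : Finset (Site 2)} (hΛ : Λ ⊆ Λ')
    (hInj' : Set.InjOn (Torus.proj (d := 2) L) ↑Λ') :
    (totalNumber : Matrix (Finset (Orb (FermionTorus 2 L))) (Finset (Orb (FermionTorus 2 L))) ℂ) -
        fermionEmbed (PolySite.toTorusEmb L hInj') (totalNumber : FermionOp Λ') ∈
      carEvenSubalgebra (orbs (Λ.image fun x => FermionTorus.ofTorusSite (Torus.proj L x)))ᶜ := by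
  rw [totalNumber_sub_fermionEmbed_totalNumber]
  refine sum_mem fun a ha => sum_mem fun σ _ => numberOp_mem_carEvenSubalgebra ?_
  refine Finset.mem_compl.2 fun h => Finset.mem_compl.1 ha ?_
  exact Finset.image_subset_image hΛ (orb_mem_orbs.1 h)

end Window

end Literature.MathematicalPhysics.QuantumLattice
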